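import Summits.KontsevichZagierPeriods.KontsevichZagierPeriods.Theses.HurwitzMicroSectors
import Summits.KontsevichZagierPeriods.KontsevichZagierPeriods.Theorems.HurwitzMicroSectorsNormalFormPrinciplePiBoxTransfer
import Summits.KontsevichZagierPeriods.KontsevichZagierPeriods.Theorems.HurwitzMicroSectorsNormalFormPrincipleVariants2339
import Summits.KontsevichZagierPeriods.KontsevichZagierPeriods.Theorems.HurwitzMicroSectorsNormalFormPrincipleVariants2283

/-! TTRL-lite variant V2355 of stmt-KontsevichZagierPeriods-3869

Variant V2355 = `stub_boxRigidity` (the leaf `BoxRigidity` of `NormalFormPrinciple`: two BOX-RATIONAL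
representations — domain the open unit box, integrand `p/q` over `ℚ`, absolutely convergent — with
equal values are KZ-equivalent) under the move `fix_nat:m'=3; bound_nat:m≤5`: the right dimension
frozen to `3`, the left one bounded by `5`. Verdict of the attempt seat: **open** — this file is the
exact-strength certificate, not a proof of the variant. By the general principle
`boxRigidityBoundFix_iff_boxVanishing` (file `…Variants2339`: one dimension frozen to `m₀ ≤ K`, the
other bounded by `K`, is exactly BoxVanishing(`K`) — compare a value-`0` representation on `(0,1)ᴷ`
with the zero representation on `(0,1)^{m₀}` one way; pad by unit intervals to the common `K`-box and
subtract the integrands, value `0` by soundness, the other way) the variant is EQUIVALENT to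
box-vanishing in dimension `5` (`stub_boxRigidity_var2355_iff_boxVanishing_five`): every box-rational
representation on `(0,1)⁵` of value `0` is a KZ relation. Hence `V2355 ⟺ V2283` (`fix m=5; m'=2`,
`stub_boxRigidity_var2355_iff_var2283`) `⟺ BoxRigidity under the joint bound m, m' ≤ 5`
(`stub_boxRigidity_var2355_iff_le_five`): Conjecture 1 for the periods `∫_{(0,1)^m} p/q`, `m ≤ 5` —
among them `ζ(5)`, `ζ(2)ζ(3)`, `π⁴ log 2`, all multiple zeta values of weight `≤ 5`, Catalan's `G`,
`Li₄(1/2)` … — whose `ℚ`-linear relations are not known (e.g. whether `ζ(5) ∈ ℚ·ζ(2)ζ(3)`), so no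
argument in the tree or the literature proves it; downward it gives BoxVanishing in every dimension
`≤ 5` (`boxVanishing_le_five_of_stub_boxRigidity_var2355`) and the sibling V2339 = BoxVanishing(`3`)
(`stub_boxRigidity_var2339_of_var2355`); upward `KontsevichZagierPeriods ⇒ parent ⇒ V2355`
(`stub_boxRigidity_var2355_of_statement`), so a refutation of the variant would refute the Summit, and
no invariant of `KZ.relations` finer than `eval` is known. (Contrast: both dimensions `≤ 1` is a theorem,
by Baker; dimension `2` is the first open level.)
Source: M. Kontsevich, D. Zagier, *Periods* (2001), §1.2 Conjecture 1 and rules 1)–3).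
Pure proof file, no definitions. -/

-- `Summit.<Summit>.<Problem>` is the tree's mandated summit-side namespace (CONVENTIONS §2); for this
-- single-conjunct summit the two coincide, so the duplicate is deliberate.
set_option linter.dupNamespace false

noncomputable section

namespace Summit.KontsevichZagierPeriods.KontsevichZagierPeriods.Theorems

open MeasureTheory Set
open Literature.NumberTheory.Transcendental Literature.NumberTheory.Transcendental.KZ
open Summit.KontsevichZagierPeriods.KontsevichZagierPeriods.Theses.HurwitzMicroSectors
open Summit.KontsevichZagierPeriods.HurwitzMicroSectors.NormalFormPrinciple.PiBox

/-! ## The variant V2355: Conjecture 1 for box-rational periods of dimension ≤ 5 -/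

/-- **V2355 ⟺ BoxVanishing in dimension `5`** (every box-rational representation on `(0,1)⁵` of
value `0` is a relation): instance `K = 5`, `m₀ = 3` of `boxRigidityBoundFix_iff_boxVanishing`.
[cite: KontsevichZagier2001, §1.2 Conjecture 1] -/
theorem stub_boxRigidity_var2355_iff_boxVanishing_five :
    (∀ (m : ℕ) (N : IntegralRep m) (N' : IntegralRep 3), m ≤ 5 → N.domain = {x | ∀ i, x i ∈ Set.Ioo (0:ℝ) 1} → N.IsRational → N'.domain = {x | ∀ i, x i ∈ Set.Ioo (0:ℝ) 1} → N'.IsRational → N.value = N'.value → Equivalent N N') ↔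
    (∀ (N : IntegralRep 5), N.domain = {x | ∀ i, x i ∈ Set.Ioo (0:ℝ) 1} → N.IsRational →
      N.value = 0 → of N ∈ relations) :=
  boxRigidityBoundFix_iff_boxVanishing (by norm_num)

/-- **V2355 ⟺ V2283** (the sibling freeze `fix m=5; m'=2`): both are BoxVanishing in dimension `5`;
the smaller dimension is idle. [cite: KontsevichZagier2001, §1.2 Conjecture 1] -/
theorem stub_boxRigidity_var2355_iff_var2283 :
    (∀ (m : ℕ) (N : IntegralRep m) (N' : IntegralRep 3), m ≤ 5 → N.domain = {x | ∀ i, x i ∈ Set.Ioo (0:ℝ) 1} → N.IsRational → N'.domain = {x | ∀ i, x i ∈ Set.Ioo (0:ℝ) 1} → N'.IsRational → N.value = N'.value → Equivalent N N') ↔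
    (∀ (N : IntegralRep 5) (N' : IntegralRep 2), N.domain = {x | ∀ i, x i ∈ Set.Ioo (0:ℝ) 1} → N.IsRational → N'.domain = {x | ∀ i, x i ∈ Set.Ioo (0:ℝ) 1} → N'.IsRational → N.value = N'.value → Equivalent N N') :=
  stub_boxRigidity_var2355_iff_boxVanishing_five.trans
    stub_boxRigidity_var2283_iff_boxVanishing_five.symm

/-- **V2355 ⟺ the two-sided bounded leaf `BoxRigidity(m, m' ≤ 5)`** (the honest strength of the
variant: freezing `m' := 3` inside the bound loses nothing). [cite: KontsevichZagier2001, §1.2 Conjecture 1] -/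
theorem stub_boxRigidity_var2355_iff_le_five :
    (∀ (m : ℕ) (N : IntegralRep m) (N' : IntegralRep 3), m ≤ 5 → N.domain = {x | ∀ i, x i ∈ Set.Ioo (0:ℝ) 1} → N.IsRational → N'.domain = {x | ∀ i, x i ∈ Set.Ioo (0:ℝ) 1} → N'.IsRational → N.value = N'.value → Equivalent N N') ↔
    (∀ (m m' : ℕ) (N : IntegralRep m) (N' : IntegralRep m'), m ≤ 5 → m' ≤ 5 →
      N.domain = {x | ∀ i, x i ∈ Set.Ioo (0:ℝ) 1} → N.IsRational →
      N'.domain = {x | ∀ i, x i ∈ Set.Ioo (0:ℝ) 1} → N'.IsRational →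
      N.value = N'.value → Equivalent N N') :=
  stub_boxRigidity_var2355_iff_var2283.trans stub_boxRigidity_var2283_iff_le_five

/-- **V2355 ⇒ BoxVanishing in every dimension `≤ 5`** (monotonicity along padding,
`boxVanishing_mono`); the first open level is `2`. [cite: KontsevichZagier2001, §1.2 Conjecture 1] -/
theorem boxVanishing_le_five_of_stub_boxRigidity_var2355
    (h : ∀ (m : ℕ) (N : IntegralRep m) (N' : IntegralRep 3), m ≤ 5 → N.domain = {x | ∀ i, x i ∈ Set.Ioo (0:ℝ) 1} → N.IsRational → N'.domain = {x | ∀ i, x i ∈ Set.Ioo (0:ℝ) 1} → N'.IsRational → N.value = N'.value → Equivalent N N')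
    {j : ℕ} (hj : j ≤ 5) (N : IntegralRep j) (hNd : N.domain = {x | ∀ i, x i ∈ Set.Ioo (0:ℝ) 1})
    (hNr : N.IsRational) (hv : N.value = 0) : of N ∈ relations :=
  boxVanishing_mono hj (stub_boxRigidity_var2355_iff_boxVanishing_five.1 h) N hNd hNr hv

/-- **V2355 ⇒ V2339** (the sibling `fix m'=2; m ≤ 3` = BoxVanishing(`3`)): descent along the
dimension. [cite: KontsevichZagier2001, §1.2 Conjecture 1] -/
theorem stub_boxRigidity_var2339_of_var2355
    (h : ∀ (m : ℕ) (N : IntegralRep m) (N' : IntegralRep 3), m ≤ 5 → N.domain = {x | ∀ i, x i ∈ Set.Ioo (0:ℝ) 1} → N.IsRational → N'.domain = {x | ∀ i, x i ∈ Set.Ioo (0:ℝ) 1} → N'.IsRational → N.value = N'.value → Equivalent N N') :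
    ∀ (m : ℕ) (N : IntegralRep m) (N' : IntegralRep 2), m ≤ 3 → N.domain = {x | ∀ i, x i ∈ Set.Ioo (0:ℝ) 1} → N.IsRational → N'.domain = {x | ∀ i, x i ∈ Set.Ioo (0:ℝ) 1} → N'.IsRational → N.value = N'.value → Equivalent N N' :=
  stub_boxRigidity_var2339_iff_boxVanishing_three.2
    fun N hNd hNr hv => boxVanishing_le_five_of_stub_boxRigidity_var2355 h (by norm_num) N hNd hNr hv

/-- **The parent leaf ⇒ V2355** (specialisation `m' := 3`, the bound `m ≤ 5` discarded).
[cite: KontsevichZagier2001, §1.2 Conjecture 1] -/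
theorem stub_boxRigidity_var2355_of_parent
    (h : ∀ (m m' : ℕ) (N : IntegralRep m) (N' : IntegralRep m'), N.domain = {x | ∀ i, x i ∈ Set.Ioo (0:ℝ) 1} → N.IsRational → N'.domain = {x | ∀ i, x i ∈ Set.Ioo (0:ℝ) 1} → N'.IsRational → N.value = N'.value → Equivalent N N') :
    ∀ (m : ℕ) (N : IntegralRep m) (N' : IntegralRep 3), m ≤ 5 → N.domain = {x | ∀ i, x i ∈ Set.Ioo (0:ℝ) 1} → N.IsRational → N'.domain = {x | ∀ i, x i ∈ Set.Ioo (0:ℝ) 1} → N'.IsRational → N.value = N'.value → Equivalent N N' :=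
  fun m N N' _ => h m 3 N N'

/-- **`KontsevichZagierPeriods ⇒ V2355`**: the variant is a special case of Conjecture 1 for the
tree's calculus — a refutation of the variant would refute the Summit.
[cite: KontsevichZagier2001, §1.2 Conjecture 1] -/
theorem stub_boxRigidity_var2355_of_statement (h : _root_.KontsevichZagierPeriods) :
    ∀ (m : ℕ) (N : IntegralRep m) (N' : IntegralRep 3), m ≤ 5 → N.domain = {x | ∀ i, x i ∈ Set.Ioo (0:ℝ) 1} → N.IsRational → N'.domain = {x | ∀ i, x i ∈ Set.Ioo (0:ℝ) 1} → N'.IsRational → N.value = N'.value → Equivalent N N' :=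
  stub_boxRigidity_var2355_of_parent (leaves_of_statement h).1

end Summit.KontsevichZagierPeriods.KontsevichZagierPeriods.Theorems
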